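import Summits.AtomisticToContinuum.Crystallization.Theorems.FrustratedLawDichotomyCellF1HostLinTable
import Summits.AtomisticToContinuum.Crystallization.Theorems.FrustratedLawDichotomyCellHostTaylor

/-!
# FrustratedLawDichotomy · crux `AperiodicFrustratedLawGap` (stmt-AtomisticToContinuum-27623) — class-A K-file tower, layer 5c (column):
the F1 HOST COLUMN, EDITION 3 («CellHostTaylor» (L1) of critic r1856 (B) / r1859 (A); decomp-a2c hand-2 g48, structural share)

Per label `host_F m := φ(t⁰_m) + φ′(t⁰_m)·gram (FᵀF − 1) (a m) (a m) − q_m` (label-wise `≤ φ(‖posL F (a m)‖²)` by (358) `phiT_posL_ge`), and the SUM over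
the window bounded on the metric box `|FᵀF − 1| ≤ ε = 2⁻¹⁰` by (358) `sum_hostLin_ge_of_readings` from the class readings of layer 5c (table) and four FOLDS
(Σ k, the window virial `S_ij = Σ_m d_m a_mi a_mj`, Σ_m ℓ_m, Σ q):

* §3 NAMED columns `kR/dR/qR` (rule G5), `hostL F`, and the label-wise facts `hk_F1`, `hd_F1`, `hq_F1`, `hρ_F1`, ★ `hhost_F1L` (the master's `hhost`);
* §4 ★ THE ONE PASS: the twelve integer folds `(Σk, Σq, 16384²Σℓ, s₀₀ … s₂₂)` decided together (`foldsL_eq`, one `decide +kernel`) and unpacked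
  (`foldl_accStep`, `folds_read`);
* §5 the real identities (`sum_kR`, `virial_entry`/`virial_sum_eq` through `aF1 m i = T_ii·z_i`, `sum_ell`, `sum_qR`) and ★★ `hostLin_sum_ge`:
  `H3 ≤ Σ_{m ∈ MF1∖0} hostL F m` for every `F` of the metric box, `H3 = -1.4154547…` FULL (`-0.7077274…` per root) vs edition 2's `host_sum_ge`
  `−1.4235639` — the F1 cell gains `+0.00405` per root, i.e. certifies at `2⁻¹⁰` (r1856 (B)).  NUMBERS = lens-5 desk HOSTTAYLOR_F1.json dd69647a to the
  last digit (Σk = -6077518466, Σq = 647764, 16384²·Σℓ = 869229389345536, s = diag(-1472058688, 577885292, 577885292), the six off-diagonal folds are 0).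
Imports TREE layer 5c (table) `…CellF1HostLinTable` + (358) `…CellHostTaylor`; 0 sorry.  Tags: [new: K-file certificates]; nothing here closes an item.
-/

namespace Summit.AtomisticToContinuum.Crystallization.Theorems.FrustratedLawDichotomyCellF1HostLin

open scoped BigOperators
open Summit.AtomisticToContinuum.Crystallization.Theorems.FrustratedLawDichotomyCellBST
open Summit.AtomisticToContinuum.Crystallization.Theorems.FrustratedLawDichotomyCoherentFloorAlgebra (phiT phiT1)
open Summit.AtomisticToContinuum.Crystallization.Theorems.FrustratedLawDichotomyCellMetric (posL gram)
open Summit.AtomisticToContinuum.Crystallization.Theorems.FrustratedLawDichotomyCellTriples (zT)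
open Summit.AtomisticToContinuum.Crystallization.Theorems.FrustratedLawDichotomyCellF1Frame (qk T TQ)
open Summit.AtomisticToContinuum.Crystallization.Theorems.FrustratedLawDichotomyCellF1Labels (labF1 qkF qkF_eq MF1 mem_M mem_labF1 labF1_nodup)
open Summit.AtomisticToContinuum.Crystallization.Theorems.FrustratedLawDichotomyCellF1Pos (aF1 aF1_eq sumSq_aF1)
open Summit.AtomisticToContinuum.Crystallization.Theorems.FrustratedLawDichotomyCellF1HostTable (phiQ phiQ_cast)
open Summit.AtomisticToContinuum.Crystallization.Theorems.FrustratedLawDichotomyCellF1HostCol (labF1' erase_MF1_eq labF1'_nodup)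
open Summit.AtomisticToContinuum.Crystallization.Theorems.FrustratedLawDichotomyCellF1HostLinTable (tQ pL pL_sound treeL treeL_ok treeL_hits)
open Summit.AtomisticToContinuum.Crystallization.Theorems.FrustratedLawDichotomyCellHostTaylor
  (gram_one_self gram_one_sub_pos second_order_le_classwise phiT_posL_ge sum_hostLin_ge_of_readings)

/-! ## §3 The named columns and the label-wise facts -/

/-- the leaf of a label (misses ↦ `0`; there are none on `MF1 ∖ 0`). -/
def leafL (m : ℤ × ℤ × ℤ) : ℤ × ℤ × ℤ := treeL.findD (qkF m) 0

/-- the integer point reading `k_{c(m)}`. -/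
def kL (m : ℤ × ℤ × ℤ) : ℤ := (leafL m).1

/-- the integer slope reading `d_{c(m)}`. -/
def dL (m : ℤ × ℤ × ℤ) : ℤ := (leafL m).2.1

/-- the integer second-order reading `q_{c(m)}`. -/
def cL (m : ℤ × ℤ × ℤ) : ℤ := (leafL m).2.2

/-- ★ NAMED column (G5): `kR m = k_{c(m)}/2³²`. -/
noncomputable def kR (m : ℤ × ℤ × ℤ) : ℝ := (kL m : ℝ) / 2 ^ 32

/-- ★ NAMED column (G5): `dR m = d_{c(m)}/2³²`. -/
noncomputable def dR (m : ℤ × ℤ × ℤ) : ℝ := (dL m : ℝ) / 2 ^ 32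

/-- ★ NAMED column (G5): `qR m = q_{c(m)}/2³²`. -/
noncomputable def qR (m : ℤ × ℤ × ℤ) : ℝ := (cL m : ℝ) / 2 ^ 32

/-- ★ THE EDITION-3 HOST of a label under the strain `F`: `φ(t⁰) + φ′(t⁰)·gram (FᵀF − 1) a a − q`. -/
noncomputable def hostL (F : Matrix (Fin 3) (Fin 3) ℝ) (m : ℤ × ℤ × ℤ) : ℝ :=
  phiT (gram 1 (aF1 m) (aF1 m)) + phiT1 (gram 1 (aF1 m) (aF1 m)) * gram (F.transpose * F - 1) (aF1 m) (aF1 m) - qR m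

/-- the template scalar of a label IS its class scalar: `gram 1 a a = t_{c(m)}`. -/
theorem gram_one_aF1 (m : ℤ × ℤ × ℤ) : gram 1 (aF1 m) (aF1 m) = ((tQ (qkF m) : ℚ) : ℝ) := by
  rw [gram_one_self, sumSq_aF1, qkF_eq]; unfold tQ; push_cast; ring

/-- on a non-root label the leaf passes the test. -/
theorem leaf_ok {m : ℤ × ℤ × ℤ} (hm : m ∈ MF1.erase 0) : pL (qkF m) (leafL m) = true := by
  rw [erase_MF1_eq, List.mem_toFinset] at hm
  exact BT.all_findD treeL_ok (treeL_hits m hm) 0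

/-- `hk`: the point reading is below `φ(t⁰)`. -/
theorem hk_F1 : ∀ m ∈ MF1.erase 0, kR m ≤ phiT (gram 1 (aF1 m) (aF1 m)) := fun m hm => by
  rw [gram_one_aF1]; exact (pL_sound (leaf_ok hm)).2.1

/-- `hd`: the slope reading is within `2⁻³³` of `φ′(t⁰)`. -/
theorem hd_F1 : ∀ m ∈ MF1.erase 0, |dR m - phiT1 (gram 1 (aF1 m) (aF1 m))| ≤ 1 / 2 ^ 33 := fun m hm => by
  rw [gram_one_aF1]; exact (pL_sound (leaf_ok hm)).2.2.1

/-- the template scalar is positive on non-root labels. -/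
theorem gram_pos_F1 {m : ℤ × ℤ × ℤ} (hm : m ∈ MF1.erase 0) : 0 < gram 1 (aF1 m) (aF1 m) := by
  rw [gram_one_aF1]; exact (pL_sound (leaf_ok hm)).1

/-- `hρ`: the label-wise second-order window is non-degenerate (`3ε < 1`). -/
theorem hρ_F1 {m : ℤ × ℤ × ℤ} (hm : m ∈ MF1.erase 0) : 0 < gram 1 (aF1 m) (aF1 m) - 1 / 1024 * (∑ i, |aF1 m i|) ^ 2 :=
  gram_one_sub_pos (by norm_num) (by norm_num) (gram_pos_F1 hm)

/-- `hq`: the label-wise second-order term is below the class reading (via the class-wise bound `ℓ ≤ 3t⁰`). -/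
theorem hq_F1 {m : ℤ × ℤ × ℤ} (hm : m ∈ MF1.erase 0) :
    (gram 1 (aF1 m) (aF1 m) - 1 / 1024 * (∑ i, |aF1 m i|) ^ 2)⁻¹ ^ 5 * (1 / 1024 * (∑ i, |aF1 m i|) ^ 2) ^ 2 ≤ qR m := by
  refine (second_order_le_classwise (by norm_num) (by norm_num) (gram_pos_F1 hm)).trans ?_
  rw [gram_one_aF1]; exact (pL_sound (leaf_ok hm)).2.2.2

/-- ★ LABEL-WISE CERTIFICATION of the edition-3 host (the master's `hhost` binder): under every `F` of the metric box, `hostL F m ≤ φ(‖posL F (aF1 m)‖²)`. -/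
theorem hhost_F1L {F : Matrix (Fin 3) (Fin 3) ℝ} (hG : ∀ i j, |(F.transpose * F) i j - (if i = j then 1 else 0)| ≤ 1 / 1024) :
    ∀ m ∈ MF1.erase 0, hostL F m ≤ phiT (‖posL F (aF1 m)‖ ^ 2) :=
  fun m hm => phiT_posL_ge hG (aF1 m) (hρ_F1 hm) (hq_F1 hm)

/-! ## §4 The one pass: twelve integer folds -/

/-- the integer `16384²·ℓ_m = (10477|z₀| + 11706|z₁| + 11706|z₂|)²`. -/
def lZ (m : ℤ × ℤ × ℤ) : ℤ := (10477 * |m.1| + 11706 * |m.2.1| + 11706 * |m.2.2|) ^ 2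

/-- one step of the accumulator `[K, Q, L, s₀₀, s₀₁, s₀₂, s₁₀, s₁₁, s₁₂, s₂₀, s₂₁, s₂₂]` (a 12-list; any other shape is left alone). -/
def accStep (p : List ℤ) (m : ℤ × ℤ × ℤ) : List ℤ :=
  match p with
  | [K, Q, L, s00, s01, s02, s10, s11, s12, s20, s21, s22] =>
    [K + kL m, Q + cL m, L + lZ m, s00 + dL m * (zT m 0 * zT m 0), s01 + dL m * (zT m 0 * zT m 1), s02 + dL m * (zT m 0 * zT m 2),
      s10 + dL m * (zT m 1 * zT m 0), s11 + dL m * (zT m 1 * zT m 1), s12 + dL m * (zT m 1 * zT m 2),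
      s20 + dL m * (zT m 2 * zT m 0), s21 + dL m * (zT m 2 * zT m 1), s22 + dL m * (zT m 2 * zT m 2)]
  | l => l

/-- the folds over the non-root labels, in ONE pass. -/
def foldsL : List ℤ := labF1'.foldl accStep [0, 0, 0, 0, 0, 0, 0, 0, 0, 0, 0, 0]

/-- ★ KERNEL FACT 3: the twelve folds (`Σk, Σq, 16384²Σℓ, s_ij`). -/
theorem foldsL_eq : foldsL = [(-6077518466), 647764, 869229389345536, (-1472058688), 0, 0, 0, 577885292, 0, 0, 0, 577885292] := by
  decide +kernel

/-- the virial fold of the pair `(i, j)`. -/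
def sL (i j : Fin 3) : ℤ := (labF1'.map fun m => dL m * (zT m i * zT m j)).sum

/-- unpacking the accumulator: each slot is the corresponding list sum. -/
theorem foldl_accStep (l : List (ℤ × ℤ × ℤ)) (K Q L s00 s01 s02 s10 s11 s12 s20 s21 s22 : ℤ) :
    l.foldl accStep [K, Q, L, s00, s01, s02, s10, s11, s12, s20, s21, s22] =
      [K + (l.map kL).sum, Q + (l.map cL).sum, L + (l.map lZ).sum,
        s00 + (l.map fun m => dL m * (zT m 0 * zT m 0)).sum, s01 + (l.map fun m => dL m * (zT m 0 * zT m 1)).sum,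
        s02 + (l.map fun m => dL m * (zT m 0 * zT m 2)).sum, s10 + (l.map fun m => dL m * (zT m 1 * zT m 0)).sum,
        s11 + (l.map fun m => dL m * (zT m 1 * zT m 1)).sum, s12 + (l.map fun m => dL m * (zT m 1 * zT m 2)).sum,
        s20 + (l.map fun m => dL m * (zT m 2 * zT m 0)).sum, s21 + (l.map fun m => dL m * (zT m 2 * zT m 1)).sum,
        s22 + (l.map fun m => dL m * (zT m 2 * zT m 2)).sum] := by
  induction l generalizing K Q L s00 s01 s02 s10 s11 s12 s20 s21 s22 with
  | nil => simp
  | cons m l ih => simp only [List.foldl_cons, accStep, ih, List.map_cons, List.sum_cons, add_assoc]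

/-- the three scalar folds and the nine virial folds, read off KERNEL FACT 3. -/
theorem folds_read : (labF1'.map kL).sum = (-6077518466) ∧ (labF1'.map cL).sum = 647764 ∧ (labF1'.map lZ).sum = 869229389345536 ∧
    sL 0 0 = (-1472058688) ∧ sL 0 1 = 0 ∧ sL 0 2 = 0 ∧ sL 1 0 = 0 ∧ sL 1 1 = 577885292 ∧ sL 1 2 = 0 ∧
    sL 2 0 = 0 ∧ sL 2 1 = 0 ∧ sL 2 2 = 577885292 := by
  have h := foldsL_eq
  rw [foldsL, foldl_accStep] at h
  simp only [zero_add, List.cons.injEq, and_true] at h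
  exact h

/-! ## §5 The real identities and the literal -/

/-- `MF1 ∖ 0`-sums of an integer column are the list folds, cast. -/
theorem sum_cast_eq (f : ℤ × ℤ × ℤ → ℤ) : ∑ m ∈ MF1.erase 0, (f m : ℝ) = (((labF1'.map f).sum : ℤ) : ℝ) := by
  rw [erase_MF1_eq, List.sum_toFinset _ labF1'_nodup, Int.cast_list_sum, List.map_map]; rfl

/-- Σ kR. -/
theorem sum_kR : ∑ m ∈ MF1.erase 0, kR m = (((-6077518466) : ℤ) : ℝ) / 2 ^ 32 := by
  have h : ∑ m ∈ MF1.erase 0, kR m = (∑ m ∈ MF1.erase 0, (kL m : ℝ)) / 2 ^ 32 := by rw [Finset.sum_div]; rfl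
  rw [h, sum_cast_eq, folds_read.1]

/-- Σ qR. -/
theorem sum_qR : ∑ m ∈ MF1.erase 0, qR m = ((647764 : ℤ) : ℝ) / 2 ^ 32 := by
  have h : ∑ m ∈ MF1.erase 0, qR m = (∑ m ∈ MF1.erase 0, (cL m : ℝ)) / 2 ^ 32 := by rw [Finset.sum_div]; rfl
  rw [h, sum_cast_eq, folds_read.2.1]

/-- the diagonal template entries `T_ii = (10477, 11706, 11706)/16384`, as reals. -/
noncomputable def Td (i : Fin 3) : ℝ := ![10477 / 16384, 11706 / 16384, 11706 / 16384] i

/-- the template entries are positive. -/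
theorem Td_pos (i : Fin 3) : 0 < Td i := by
  fin_cases i <;> simp [Td]

/-- the template is diagonal: `a_m i = T_ii · z_i`. -/
theorem aF1_apply (m : ℤ × ℤ × ℤ) (i : Fin 3) : aF1 m i = Td i * (zT m i : ℝ) := by
  rw [aF1_eq]
  unfold T TQ
  fin_cases i <;> simp [Matrix.mulVec, dotProduct, Fin.sum_univ_three, Td] <;> norm_num

/-- the virial entry of the pair `(i, j)`: `Σ_m dR m·a_mi·a_mj = T_ii T_jj s_ij / 2³²`. -/
theorem virial_entry (i j : Fin 3) : ∑ m ∈ MF1.erase 0, dR m * (aF1 m i * aF1 m j) = Td i * Td j / 2 ^ 32 * (sL i j : ℝ) := by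
  have h : ∀ m, dR m * (aF1 m i * aF1 m j) = Td i * Td j / 2 ^ 32 * ((dL m * (zT m i * zT m j) : ℤ) : ℝ) := by
    intro m; rw [aF1_apply, aF1_apply]; unfold dR; push_cast; ring
  simp_rw [h]
  rw [← Finset.mul_sum, sum_cast_eq]; rfl

/-- the absolute virial entry: `|Σ_m dR m·a_mi·a_mj| = T_ii T_jj |s_ij| / 2³²`. -/
theorem abs_virial_entry (i j : Fin 3) : |∑ m ∈ MF1.erase 0, dR m * (aF1 m i * aF1 m j)| = Td i * Td j / 2 ^ 32 * ((|sL i j| : ℤ) : ℝ) := by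
  rw [virial_entry, abs_mul, abs_of_pos (by have := Td_pos i; have := Td_pos j; positivity), Int.cast_abs]

/-- the first-order (virial) column, in closed form (the six off-diagonal folds vanish; `T₁ = T₂`). -/
theorem virial_sum_eq : ∑ i, ∑ j, |∑ m ∈ MF1.erase 0, dR m * (aF1 m i * aF1 m j)| =
    ((10477 / 16384 : ℝ) * (10477 / 16384) * 1472058688 + 2 * ((11706 / 16384 : ℝ) * (11706 / 16384) * 577885292)) / 2 ^ 32 := by
  simp_rw [abs_virial_entry]
  obtain ⟨-, -, -, h00, h01, h02, h10, h11, h12, h20, h21, h22⟩ := folds_read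
  simp only [Fin.sum_univ_three, h00, h01, h02, h10, h11, h12, h20, h21, h22, Td]
  simp only [Matrix.cons_val_zero, Matrix.cons_val_one, Matrix.head_cons, Matrix.cons_val_two, Matrix.tail_cons]
  norm_num

/-- `ℓ_m` in closed form: `(Σ_i |a_m i|)² = lZ m / 16384²`. -/
theorem ell_eq (m : ℤ × ℤ × ℤ) : (∑ i, |aF1 m i|) ^ 2 = (lZ m : ℝ) / 16384 ^ 2 := by
  simp only [Fin.sum_univ_three, aF1_apply, abs_mul, abs_of_pos (Td_pos _), lZ]
  have hz0 : (zT m 0 : ℝ) = (m.1 : ℝ) := by simp [zT]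
  have hz1 : (zT m 1 : ℝ) = (m.2.1 : ℝ) := by simp [zT]
  have hz2 : (zT m 2 : ℝ) = (m.2.2 : ℝ) := by simp [zT]
  rw [hz0, hz1, hz2]
  simp only [Td, Matrix.cons_val_zero, Matrix.cons_val_one, Matrix.head_cons, Matrix.cons_val_two, Matrix.tail_cons]
  push_cast
  ring

/-- Σ ℓ. -/
theorem sum_ell : ∑ m ∈ MF1.erase 0, (∑ i, |aF1 m i|) ^ 2 = ((869229389345536 : ℤ) : ℝ) / 16384 ^ 2 := by
  simp_rw [ell_eq]
  rw [← Finset.sum_div, sum_cast_eq, folds_read.2.2.1]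

/-- ★ THE LITERAL `H3` of the edition-3 host column (exact rational; `= -1.4154547…` FULL, `-0.7077274…` per root). -/
def H3 : ℚ := (-52221062686455131577) / 36893488147419103232

/-- ★★ **THE F1 HOST COLUMN, EDITION 3**: on the metric box `|FᵀF − 1| ≤ 2⁻¹⁰`, `H3 ≤ Σ_{m ∈ MF1∖0} hostL F m` (the master's `hH` binder with
`host := hostL F`, `hhost := hhost_F1L hG`). -/
theorem hostLin_sum_ge {F : Matrix (Fin 3) (Fin 3) ℝ} (hG : ∀ i j, |(F.transpose * F) i j - (if i = j then 1 else 0)| ≤ 1 / 1024) :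
    ((H3 : ℚ) : ℝ) ≤ ∑ m ∈ MF1.erase 0, hostL F m := by
  have h := sum_hostLin_ge_of_readings (MF1.erase 0) aF1 (ε := 1 / 1024) (η := 1 / 2 ^ 33) (by norm_num) hG kR dR qR hk_F1 hd_F1
  rw [sum_kR, virial_sum_eq, sum_ell, sum_qR] at h
  refine le_trans ?_ h
  unfold H3
  push_cast
  norm_num

end Summit.AtomisticToContinuum.Crystallization.Theorems.FrustratedLawDichotomyCellF1HostLin
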